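import Mathlib
import HarnessLib
import Literature.MathematicalPhysics.StatisticalMechanics.CovarianceComparisonSegment
import Literature.MathematicalPhysics.StatisticalMechanics.CovarianceComparisonShellRatio
import Literature.MathematicalPhysics.StatisticalMechanics.TorusFiniteRangeDecomposition

/-!
# [ABKM19] (7.75) for the torus decomposition: `Re 𝒞̂_{A₀+TB,k}(κ) ≤ (1+ρ) Re 𝒞̂_{A₀,k}(κ)` along an
# elliptic segment, from clauses (iv) and (v) of `GradientFRD.TorusFRD`

Discharge of the three hypotheses of `CovarianceComparisonSegment.re_fourierCoeff_segment_le_one_add_mul`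
from the clause shapes of the finite-range decomposition `GradientFRD.TorusFRD` (Buchholz 2018,
Thm 2.4) for a kernel package `𝒞A : A ↦ k ↦ kernel` at fixed `L, N, M`: clause (iv) (smooth
dependence of the real-space kernels on the coefficient matrix along unit symmetric directions) gives
the differentiability of every `s ↦ 𝒞A (A + sB) k x` at `0`; clause (v) gives the LOWER shell bound
of `Re 𝒞̂_{A,k}(κ)` and the derivative bound with `ℓ = 1` (`iteratedDeriv 1 = deriv`); the ratio of the
two is `shellRatioConst c C₁ L d ñ = (C₁/c)L^{4(d+ñ)+2}` (`CovarianceComparisonShellRatio`) in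
both shell cases `j < k`, `k ≤ j`.  Result:

* **`re_fourierCoeff_le_one_add_mul_of_torusFRD`** — for an elliptic segment `A₀ + tB`, `t ∈ [0, T]`,
  `B` unit symmetric, `1 ≤ k ≤ N+1`, `κ ≠ 0` in shell `j`, and `K T ≤ log (1+ρ)`:
  `Re 𝒞̂_{A₀+TB,k}(κ) ≤ (1+ρ) · Re 𝒞̂_{A₀,k}(κ)` — [ABKM19] (7.75) with `κ(ρ, L) = log(1+ρ)/K`.

Everything is proved; no named fact (the hypotheses are exactly clauses (iv), (v) of `TorusFRD d`
quantified over the elliptic class, as delivered by `TorusFRD_holds d`).  Not here: the choice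
`A₀ = 1`, `B = q/‖q‖` and the packaging as `StepKernelBounds` via
`AbkmWeightBounds.stepKernelBounds_of_multipliers_le` (same `obtain` of `TorusFRD_holds` as the weights).

## References
* S. Adams, S. Buchholz, R. Kotecký, S. Müller, arXiv:1910.13564, Lemma 7.7, (7.74)–(7.75)
  [AdamsBuchholzKoteckyMuller2019].
* S. Buchholz, J. Funct. Anal. 275 (2018), Thm 2.4 [Buchholz2016].
-/

noncomputable section

namespace Literature.MathematicalPhysics.StatisticalMechanics.GradientRG

open Real Set
open Literature.MathematicalPhysics.StatisticalMechanics.GradientFRD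
  (fourierCoeff IsElliptic IsUnitSymm InShell)

variable {d M : ℕ} [NeZero M]

/-- **[ABKM19] (7.75) for the torus decomposition.**  Let `𝒞A : A ↦ k ↦ 𝒞_{A,k}` satisfy, for every
elliptic `A`, clause (iv) of `TorusFRD` (smoothness in `A` along unit symmetric directions, here only
the existence of a neighbourhood of differentiability is used) and clause (v) (two-sided shell bounds
and the derivative bounds with constants `c > 0`, `C`, `Cℓ`; `n ≤ ñ`, `L ≥ 1`).  Then along an elliptic
segment `A₀ + tB`, `t ∈ [0,T]`, `B` unit symmetric, for `1 ≤ k ≤ N+1`, `κ ≠ 0` in shell `j`, `ρ > −1` and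
`shellRatioConst c (Cℓ 1) L d ñ · T ≤ log (1+ρ)`:
`Re 𝒞̂_{A₀+TB,k}(κ) ≤ (1+ρ) · Re 𝒞̂_{A₀,k}(κ)`. [cite: AdamsBuchholzKoteckyMuller2019, Lemma 7.7 (7.75)] -/
theorem re_fourierCoeff_le_one_add_mul_of_torusFRD
    {𝒞A : Matrix (Fin d) (Fin d) ℝ → ℕ → (Fin d → ZMod M) → ℝ} {ω₀ Ω₀ c C : ℝ} {Cℓ : ℕ → ℝ}
    {Cα : (Fin d → ℕ) → ℕ → ℝ} {L N n ñ : ℕ}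
    (hiv : ∀ A : Matrix (Fin d) (Fin d) ℝ, IsElliptic ω₀ Ω₀ A →
      ∀ k, 1 ≤ k → k ≤ N + 1 → ∀ B : Matrix (Fin d) (Fin d) ℝ, IsUnitSymm B →
        (∃ ε : ℝ, 0 < ε ∧ ∀ x : Fin d → ZMod M,
          ContDiffOn ℝ ⊤ (fun s : ℝ => 𝒞A (A + s • B) k x) (Set.Ioo (-ε) ε)) ∧
        ∀ α : Fin d → ℕ, ∑ i, α i ≤ n → ∀ ℓ : ℕ, ∀ x : Fin d → ZMod M,
          abs (iteratedDeriv ℓ (fun s : ℝ => GradientFRD.iterDiff α (𝒞A (A + s • B) k) x) 0)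
            ≤ Cα α ℓ / (L : ℝ) ^ ((k - 1) * (d - 2 + ∑ i, α i)))
    (hv : ∀ A : Matrix (Fin d) (Fin d) ℝ, IsElliptic ω₀ Ω₀ A →
      ∀ k, 1 ≤ k → k ≤ N + 1 → ∀ j : ℕ, ∀ κ : Fin d → ZMod M, κ ≠ 0 → InShell L j κ →
        (j < k →
          c / (L : ℝ) ^ (2 * (d + ñ) + 1) * (L : ℝ) ^ (2 * j)
              / (L : ℝ) ^ ((k - j) * (d - 1 + n)) ≤ (fourierCoeff (𝒞A A k) κ).re ∧
          ‖fourierCoeff (𝒞A A k) κ‖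
            ≤ C * (L : ℝ) ^ (2 * (d + ñ) + 1) * (L : ℝ) ^ (2 * j)
                / (L : ℝ) ^ ((k - j) * (d - 1 + n))) ∧
        (k ≤ j →
          c / (L : ℝ) ^ (2 * (d + ñ) + 1) * (L : ℝ) ^ (2 * k)
              ≤ (fourierCoeff (𝒞A A k) κ).re ∧
          ‖fourierCoeff (𝒞A A k) κ‖ ≤ C * (L : ℝ) ^ (2 * k)) ∧
        ∀ B : Matrix (Fin d) (Fin d) ℝ, IsUnitSymm B → ∀ ℓ : ℕ, 1 ≤ ℓ →
          (j < k →
            ‖iteratedDeriv ℓ (fun s : ℝ => fourierCoeff (𝒞A (A + s • B) k) κ) 0‖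
              ≤ Cℓ ℓ * (L : ℝ) ^ (2 * (d + ñ) + 1) * (L : ℝ) ^ (2 * j)
                  / (L : ℝ) ^ ((k - j) * (d - 1 + ñ))) ∧
          (k ≤ j →
            ‖iteratedDeriv ℓ (fun s : ℝ => fourierCoeff (𝒞A (A + s • B) k) κ) 0‖
              ≤ Cℓ ℓ * (L : ℝ) ^ (2 * k)))
    (hc : 0 < c) (hC1 : 0 ≤ Cℓ 1) (hL : 1 ≤ L) (hn : n ≤ ñ)
    {A₀ B : Matrix (Fin d) (Fin d) ℝ} (hB : IsUnitSymm B) {T : ℝ} (hT : 0 ≤ T)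
    (hell : ∀ t ∈ Icc 0 T, IsElliptic ω₀ Ω₀ (A₀ + t • B))
    {k : ℕ} (hk1 : 1 ≤ k) (hkN : k ≤ N + 1) {κ : Fin d → ZMod M} (hκ : κ ≠ 0) {j : ℕ}
    (hj : InShell L j κ) {ρ : ℝ} (hρ : -1 < ρ)
    (hKT : shellRatioConst c (Cℓ 1) (L : ℝ) d ñ * T ≤ Real.log (1 + ρ)) :
    (fourierCoeff (𝒞A (A₀ + T • B) k) κ).re ≤ (1 + ρ) * (fourierCoeff (𝒞A A₀ k) κ).re := by
  have hLr : (1 : ℝ) ≤ (L : ℝ) := by exact_mod_cast hL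
  have hL0 : (0 : ℝ) < (L : ℝ) := by linarith
  have hK : 0 ≤ shellRatioConst c (Cℓ 1) (L : ℝ) d ñ := shellRatioConst_nonneg hc hC1 hL0.le d ñ
  -- differentiability of the real-space values along the segment (clause (iv))
  have hdiff : ∀ t ∈ Icc 0 T, ∀ x, DifferentiableAt ℝ
      (fun s : ℝ => (fun A => 𝒞A A k) (A₀ + t • B + s • B) x) 0 := by
    intro t ht x
    obtain ⟨ε, hε, hcd⟩ := (hiv (A₀ + t • B) (hell t ht) k hk1 hkN B hB).1
    have hmem : Set.Ioo (-ε) ε ∈ nhds (0 : ℝ) := Ioo_mem_nhds (by linarith) hε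
    exact ((hcd x).differentiableOn (by simp)).differentiableAt hmem
  -- the derivative bound with `ℓ = 1` (clause (v)) along the segment
  have hder : ∀ t ∈ Icc 0 T,
      ‖deriv (fun s : ℝ => fourierCoeff ((fun A => 𝒞A A k) (A₀ + t • B + s • B)) κ) 0‖ =
        ‖iteratedDeriv 1 (fun s : ℝ => fourierCoeff (𝒞A ((A₀ + t • B) + s • B) k) κ) 0‖ := by
    intro t _; rw [iteratedDeriv_one]
  rcases lt_or_ge j k with hjk | hkj
  · -- shells `j < k`
    set lower : ℝ := c / (L : ℝ) ^ (2 * (d + ñ) + 1) * (L : ℝ) ^ (2 * j) / (L : ℝ) ^ ((k - j) * (d - 1 + n))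
      with hlower
    set upper : ℝ := Cℓ 1 * (L : ℝ) ^ (2 * (d + ñ) + 1) * (L : ℝ) ^ (2 * j) / (L : ℝ) ^ ((k - j) * (d - 1 + ñ))
      with hupper
    have hlow : ∀ t ∈ Icc 0 T, lower ≤ (fourierCoeff ((fun A => 𝒞A A k) (A₀ + t • B)) κ).re :=
      fun t ht => ((hv (A₀ + t • B) (hell t ht) k hk1 hkN j κ hκ hj).1 hjk).1
    have hup : ∀ t ∈ Icc 0 T,
        ‖deriv (fun s : ℝ => fourierCoeff ((fun A => 𝒞A A k) (A₀ + t • B + s • B)) κ) 0‖ ≤ upper := by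
      intro t ht
      rw [hder t ht]
      exact ((hv (A₀ + t • B) (hell t ht) k hk1 hkN j κ hκ hj).2.2 B hB 1 le_rfl).1 hjk
    have hratio : upper ≤ shellRatioConst c (Cℓ 1) (L : ℝ) d ñ * lower :=
      deriv_shell_bound_le_ratio_mul_lower_lt hc hC1 hLr hn
    have hlower0 : 0 ≤ lower := by rw [hlower]; positivity
    exact re_fourierCoeff_segment_le_one_add_mul (𝒦 := fun A => 𝒞A A k) hT κ hdiff hup hlow hK hratio
      hρ hKT hlower0
  · -- shells `k ≤ j`
    set lower : ℝ := c / (L : ℝ) ^ (2 * (d + ñ) + 1) * (L : ℝ) ^ (2 * k) with hlower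
    set upper : ℝ := Cℓ 1 * (L : ℝ) ^ (2 * k) with hupper
    have hlow : ∀ t ∈ Icc 0 T, lower ≤ (fourierCoeff ((fun A => 𝒞A A k) (A₀ + t • B)) κ).re :=
      fun t ht => ((hv (A₀ + t • B) (hell t ht) k hk1 hkN j κ hκ hj).2.1 hkj).1
    have hup : ∀ t ∈ Icc 0 T,
        ‖deriv (fun s : ℝ => fourierCoeff ((fun A => 𝒞A A k) (A₀ + t • B + s • B)) κ) 0‖ ≤ upper := by
      intro t ht
      rw [hder t ht]
      exact ((hv (A₀ + t • B) (hell t ht) k hk1 hkN j κ hκ hj).2.2 B hB 1 le_rfl).2 hkj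
    have hratio : upper ≤ shellRatioConst c (Cℓ 1) (L : ℝ) d ñ * lower :=
      deriv_shell_bound_le_ratio_mul_lower_le hc hC1 hLr
    have hlower0 : 0 ≤ lower := by rw [hlower]; positivity
    exact re_fourierCoeff_segment_le_one_add_mul (𝒦 := fun A => 𝒞A A k) hT κ hdiff hup hlow hK hratio
      hρ hKT hlower0

end Literature.MathematicalPhysics.StatisticalMechanics.GradientRG

end
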